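import Mathlib
import Summits.ValiantsHypothesis.ValiantsHypothesis.Theorems.GrenetZeonTwoDimCoefficientsDualUnipotentCommutativeRepr

/-!
# Route `GrenetZeon`, frontier rung `DualUnipotentThreeHalves` (stmt-ValiantsHypothesis-24318):
# the rung holds on the COMMUTATIVE locus of the unipotent dual model (with an exponential margin)

The support item 24318 asks, for `per_n = α·det A + β·tr(adj A·B)` (`A`, `B` affine `m × m`, `det A ≡ c ≠ 0`),
for the first superlinear bound `n³ ≤ C·m²`; its line `slow_core` isolates the research stub
`stub_longMassSlowLawInv` (a per-agnostic law on irreducible nilpotent pencils).  This file records that on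
the COMMUTATIVE locus — all coefficient matrices of `A` (constant and linear) pairwise commute — the rung
holds outright, as a corollary of the commutative rung of the crux 8062 (✓ `sq_le_of_dualUnipotentRepr_commutative`,
`n² ≤ 17·m`, `…DualUnipotentCommutativeRepr.lean`; ✓ `choose_sq_le_of_dualUnipotentRepr_commutative`,
`C(n,k)² ≤ (n²+1)·m²`):

* `cube_le_of_dualUnipotentRepr_commutative` — `n³ ≤ 289·m²` (`n ≥ 4`);
* `dualUnipotentThreeHalves_of_commutative_repr` — ★ the item's signature with its hypothesis unfolded
  VERBATIM plus the single conjunct «the coefficient matrices of `A` pairwise commute», `C = 289`, `n₀ = 4`;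
* `four_pow_le_of_dualUnipotentRepr_commutative` — the exponential form `4^n ≤ (n+1)²·(n²+1)·m²` in this
  currency (so on the commutative locus the model is no better than Ryser–Glynn-type formulas up to `poly(n)`).

HONEST FRAMING: a sub-locus corollary (def-free helper, `--supports stmt-ValiantsHypothesis-24318`); the stub
`stub_longMassSlowLawInv`, the items 24318 / 8062 and `VP ≠ VNP` are NOT proved; the open core of both items is
the NON-commutative (wild) pencil.

References: J. M. Landsberg, *Geometry and Complexity Theory* (CUP 2017), Exercise 6.2.2.7 (flattening ranks of
`per_n`); T. Mignon, N. Ressayre, Int. Math. Res. Not. 2004:79 (context).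
-/

-- single-conjunct layout: the duplicated namespace component is mandated by the tree.
set_option linter.dupNamespace false

noncomputable section

namespace Summit.ValiantsHypothesis.ValiantsHypothesis.Cruxes.TwoDimCoefficients.DimTwoCases

open MvPolynomial Matrix
open Literature.Computability.AlgebraicComplexity

variable {n m : ℕ}

/-- **The 3/2 rung on the commutative locus**: `DualUnipotentRepr` data whose matrix `A` has pairwise commuting
coefficient matrices force `n³ ≤ 289·m²` (`n ≥ 4`; from `n² ≤ 17·m`). [folklore] -/
theorem cube_le_of_dualUnipotentRepr_commutative (hn : 4 ≤ n) {α β c : ℂ} {A B : AffMat n m} (hA : IsAffine A)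
    (hB : IsAffine B) (hc : c ≠ 0) (hdet : A.det = C c)
    (hper : perPoly (Fin n) ℂ = C α * A.det + C β * (A.adjugate * B).trace)
    (hcomm : ∀ d₁ d₂ : (Fin n × Fin n) →₀ ℕ, Commute (A.map (coeff d₁)) (A.map (coeff d₂))) :
    n ^ 3 ≤ 289 * m ^ 2 := by
  have h := sq_le_of_dualUnipotentRepr_commutative hn hA hB hc hdet hper hcomm
  have h4 : n ^ 4 ≤ 289 * m ^ 2 := by
    calc n ^ 4 = (n ^ 2) ^ 2 := by ring
      _ ≤ (17 * m) ^ 2 := Nat.pow_le_pow_left h 2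
      _ = 289 * m ^ 2 := by ring
  calc n ^ 3 ≤ n ^ 4 := Nat.pow_le_pow_right (by omega) (by norm_num)
    _ ≤ 289 * m ^ 2 := h4

/-- ★ **`DualUnipotentThreeHalves` ON THE COMMUTATIVE LOCUS** — the signature of stmt-ValiantsHypothesis-24318
with its hypothesis unfolded verbatim and ONE extra conjunct (the coefficient matrices of `A` pairwise commute),
with `C = 289`, `n₀ = 4`. [folklore] -/
theorem dualUnipotentThreeHalves_of_commutative_repr :
    ∃ C n₀ : ℕ, ∀ n ≥ n₀, ∀ m : ℕ,
      (∃ (α β c : ℂ) (A B : Matrix (Fin m) (Fin m) (MvPolynomial (Fin n × Fin n) ℂ)),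
        (∀ i j, (A i j).totalDegree ≤ 1) ∧ (∀ i j, (B i j).totalDegree ≤ 1) ∧ c ≠ 0 ∧
        A.det = MvPolynomial.C c ∧
        perPoly (Fin n) ℂ = MvPolynomial.C α * A.det + MvPolynomial.C β * (A.adjugate * B).trace ∧
        ∀ d₁ d₂ : (Fin n × Fin n) →₀ ℕ, Commute (A.map (coeff d₁)) (A.map (coeff d₂))) →
      n ^ 3 ≤ C * m ^ 2 := by
  refine ⟨289, 4, fun n hn m h => ?_⟩
  obtain ⟨α, β, c, A, B, hA, hB, hc, hdet, hper, hcomm⟩ := h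
  exact cube_le_of_dualUnipotentRepr_commutative hn hA hB hc hdet hper hcomm

/-- **Exponential form in the native currency**: on the commutative locus `4^n ≤ (n+1)²·(n²+1)·m²` (`n ≥ 2`).
[folklore] -/
theorem four_pow_le_of_dualUnipotentRepr_commutative (hn : 2 ≤ n) {α β c : ℂ} {A B : AffMat n m}
    (hA : IsAffine A) (hB : IsAffine B) (hc : c ≠ 0) (hdet : A.det = C c)
    (hper : perPoly (Fin n) ℂ = C α * A.det + C β * (A.adjugate * B).trace)
    (hcomm : ∀ d₁ d₂ : (Fin n × Fin n) →₀ ℕ, Commute (A.map (coeff d₁)) (A.map (coeff d₂))) :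
    4 ^ n ≤ (n + 1) ^ 2 * ((n ^ 2 + 1) * m ^ 2) := by
  -- `C(n, n/2) ≥ 2^n/(n+1)` and the flattening bound at `k = n/2 ≥ 1`
  have h2 : 2 ^ n ≤ (n + 1) * n.choose (n / 2) := by
    rw [← Nat.sum_range_choose n]
    calc ∑ i ∈ Finset.range (n + 1), n.choose i
        ≤ ∑ _i ∈ Finset.range (n + 1), n.choose (n / 2) :=
          Finset.sum_le_sum fun i _ => Nat.choose_le_middle i n
      _ = (n + 1) * n.choose (n / 2) := by rw [Finset.sum_const, Finset.card_range, smul_eq_mul]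
  have h4 : (4 : ℕ) ^ n = (2 ^ n) ^ 2 := by
    rw [← pow_mul, mul_comm, pow_mul]
    norm_num
  have hk := choose_sq_le_of_dualUnipotentRepr_commutative hA hB hc hdet hper hcomm (show 1 ≤ n / 2 by omega)
  calc 4 ^ n = (2 ^ n) ^ 2 := h4
    _ ≤ ((n + 1) * n.choose (n / 2)) ^ 2 := Nat.pow_le_pow_left h2 2
    _ = (n + 1) ^ 2 * (n.choose (n / 2)) ^ 2 := by ring
    _ ≤ (n + 1) ^ 2 * ((n ^ 2 + 1) * m ^ 2) := Nat.mul_le_mul_left _ hk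

end Summit.ValiantsHypothesis.ValiantsHypothesis.Cruxes.TwoDimCoefficients.DimTwoCases

end
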